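import Summits.Ventures.YMGap.RobustBall.StringTensionExplicit
import HarnessLib

/-!
# Robust ball (Y2), area-law side — explicit-rate area law and string-tension floor through the AFFINE-VERTEX door

HONEST FRAMING: venture file of the cell `pub-ymgap` (QuantumFields programme), track ROBUST-BALL, seat rb-p2 (g4).  Vertex twin of
`RobustAreaLawExplicit` / `StringTensionExplicit`: the site-dependent robust slab door (`slab_covariance_le_W_site`, DESIGN §6) bounds the
Dobrushin rows of a member of `ClusterDomainFR ε₀ ε₁ r` by the AFFINE-VERTEX constant `c_v = e^{ε₀} c_W + max(2√N e^{ε₀} c_W, √N)·ε₁`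
(`c_W = 2n|β/N|K`) instead of the lossy `e^{ε₀}(1 + 2√N ε₁) c_W + √N ε₁`; here it is run WITHOUT the cap `max(·, 1/2)` (any `c` with
`c_v ≤ c ≤ 1`, `c > 0`) and through the FULL-RATE criterion, giving for every torus, member and loop
`|⟨W_{R'×T}⟩_{β,W,L}| ≤ N (32N³/c)^T e^{−((−log c)/(r_W mv)) R' T}`, hence `HasAreaLawWith μ χ_N (32N³/c) ((−log c)/(r_W mv))` and the
string-tension floor `(−log c)/(r_W mv)` for every infinite-volume limit state of every eventually-member family (whenever `σ` exists);
certified SU(2) `d = 4` cell on the sprint's ball of record `(1/8; 37/125, 37/250)`: `c_v ≤ 47/100`, floor `log(100/47)/(max(3r,1)·mv)`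
(`log(100/47) ≥ 0.755`; the lossy door gives `log(100/57) ≥ 0.562`).  LATTICE, strong coupling; rates are door artefacts; existence of `σ`
not claimed for non-Wilson members; nothing continuum / spectral / Clay.

References: Cao–Nissim–Sheffield arXiv:2509.04688v2 Thm 2.3; H. Föllmer, LNM 1362 (1988) Ch. I; E. Seiler, LNP 159 (1982) §2.
-/

noncomputable section

open MeasureTheory ProbabilityTheory Filter Topology
open scoped Matrix
open Literature.Probability.LatticeModels hiding glue
open Literature.Probability.LatticeModels.DobrushinMetric
open Literature.MathematicalPhysics.QuantumLattice (fundamentalRep continuous_fundamentalRep fundamentalRep_apply normalisedCharacter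
  LGConfig HasAreaLawWith HasStringTension infiniteVolumeLimitPoints)
open Literature.MathematicalPhysics.QuantumFieldTheory
open Literature.MathematicalPhysics.QuantumFieldTheory.DurhuusFrohlich
open Literature.MathematicalPhysics.QuantumFieldTheory.Balaban1983to89.StrongCouplingDobrushinWindow (OneLinkKRModulus)

namespace Summit.Ventures.YMGap.RobustBall

namespace ExplicitVertex

variable {n L N : ℕ}

section Door

variable [NeZero L] {W : GaugeConfig (n + 1) L (SU N) → ℝ}

/-- **The site-dependent robust slab door, UNCAPPED**: as the landed `slabLawW_entry_cov_le_site`, with the Dobrushin row parameter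
`0 < c ≤ 1` used as its own floor: `|Cov_{slabLawW}(φ(Q_x)_{ij}, ψ(Q_y⁻¹)_{kl})| ≤ (8N/c) e^{−((−log c)/r_W) d(x,y)}`.
[cite: CaoNissimSheffield2025dynamical, Theorem 2.3] [cite: Follmer1988, Ch. I Theorem (2.13)] -/
theorem slabLawW_entry_cov_le_site_pos (hN : 1 ≤ N) (v : Fin (n + 1)) (t : ZMod L)
    {β R K δ c : ℝ} (hK : 0 ≤ K) (ℓ Λ₀ : TorusSite n L → ℝ) (hℓ : ∀ x, 0 ≤ ℓ x) (hR : |β| * (2 * (n : ℝ)) ≤ R)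
    (hmod : OneLinkKRModulus N R K)
    (hWm : Measurable W) (hWb : ∃ C, ∀ U, |W U| ≤ C) (r : {e : Edge (n + 1) L // ¬ IsSlab v t e} → SU N)
    (nbrW : TorusSite n L → Finset (TorusSite n L)) (hnotW : ∀ x, x ∉ nbrW x)
    (hdep : ∀ x (η η' : TorusSite n L → SU N), (∀ z ∈ Slab.slabNbr x ∪ nbrW x, η z = η' z) →
      ∃ c : ℝ, ∀ g, siteTiltW v t W r x η g = c + siteTiltW v t W r x η' g)
    (hδ : ∀ x ω g g', siteTiltW v t W r x ω g - siteTiltW v t W r x ω g' ≤ δ)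
    (hℓ' : ∀ x ω g g', |siteTiltW v t W r x ω g - siteTiltW v t W r x ω g'| ≤ ℓ x * suFrobDist g g')
    (Λ : TorusSite n L → TorusSite n L → ℝ) (hΛ0 : ∀ x y, 0 ≤ Λ x y)
    (hΛ : ∀ x y (ω η : TorusSite n L → SU N), (∀ z, z ≠ y → ω z = η z) → ∃ c : ℝ, ∀ g,
      |siteTiltW v t W r x ω g - (c + siteTiltW v t W r x η g)| ≤ Λ x y * suFrobDist (ω y) (η y))
    (hrow : ∀ x, ∑ y ∈ Slab.slabNbr x ∪ nbrW x, Λ x y ≤ Λ₀ x) (hc0 : 0 < c) (hc1 : c ≤ 1)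
    (hrowc : ∀ x, Real.exp δ * (1 + 2 * Real.sqrt N * ℓ x) * (2 * (n : ℝ) * |β| * K) + Real.sqrt N * Λ₀ x ≤ c)
    {rW : ℕ} (hrW : 1 ≤ rW) (hrange : ∀ z, ∀ w ∈ Slab.slabNbr z ∪ nbrW z, torusGraphDist z w ≤ rW)
    (x y : TorusSite n L) (i j k l : Fin N) (φ ψ : ℂ → ℝ)
    (hφ : φ = Complex.re ∨ φ = Complex.im) (hψ : ψ = Complex.re ∨ ψ = Complex.im) :
    |cov[fun Q => φ ((Q x : Matrix (Fin N) (Fin N) ℂ) i j),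
        fun Q => ψ ((((Q y)⁻¹ : Matrix.specialUnitaryGroup (Fin N) ℂ) : Matrix (Fin N) (Fin N) ℂ) k l);
        slabLawW v t β W r]| ≤
      8 * N * c⁻¹ * Real.exp (-(-Real.log c / rW) * torusGraphDist x y) := by
  classical
  haveI := isProbabilityMeasure_slabLawW (n := n) (L := L) (N := N) v t β hWm hWb r
  obtain ⟨hfm, hfdep, hf1, hfL⟩ := Slab.entryObs_props (n := n) (L := L) x i j hφ
  obtain ⟨hgm, hgdep, hg1, hgL⟩ := Slab.invEntryObs_props (n := n) (L := L) y k l hψ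
  have hN8 : (2 : ℝ) * (2 * Real.sqrt N) ^ 2 = 8 * N := by
    rw [mul_pow, Real.sq_sqrt (Nat.cast_nonneg N)]; ring
  have hNr : (1 : ℝ) ≤ N := by exact_mod_cast hN
  by_cases hL1 : L = 1
  · subst hL1
    have hxy : x = y := Subsingleton.elim _ _
    subst hxy
    have h4 := Slab.abs_cov_le_of_abs_le (μ := slabLawW v t β W r) hf1 hg1
    rw [torusGraphDist_self, Nat.cast_zero, mul_zero, Real.exp_zero, mul_one]
    have hinv : (1 : ℝ) ≤ c⁻¹ := one_le_inv_iff₀.2 ⟨hc0, hc1⟩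
    calc _ ≤ 2 * 1 * (2 * 1) := h4
      _ ≤ 8 * N * c⁻¹ := by nlinarith
  · obtain ⟨hp0, hp⟩ := div_profile (n := n) (L := L) y hrW (fun z => Slab.slabNbr z ∪ nbrW z) hrange
    have key := slab_covariance_le_W_site hN hL1 v t hK ℓ Λ₀ hℓ hR hmod hWm hWb r nbrW hnotW hdep hδ hℓ' Λ hΛ0 hΛ hrow
      hc0.le hc1 hrowc x y hfm hfdep hf1 hfL hgm hgdep hg1 hgL (fun z => torusGraphDist z y / rW) hp0 hp
    have hexp := pow_div_le_exp_of_le hc0.le le_rfl hc0 hc1 hrW (torusGraphDist x y)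
    calc _ ≤ 2 * (2 * Real.sqrt N) ^ 2 * 1 * (c ^ (torusGraphDist x y / rW) * 1) := key
      _ = 8 * N * c ^ (torusGraphDist x y / rW) := by rw [← hN8]; ring
      _ ≤ 8 * N * (c⁻¹ * Real.exp (-(-Real.log c / rW) * torusGraphDist x y)) :=
          mul_le_mul_of_nonneg_left hexp (by positivity)
      _ = 8 * N * c⁻¹ * Real.exp (-(-Real.log c / rW) * torusGraphDist x y) := by ring

end Door

section Ball

/-- **Slab covariance on the ball, affine-vertex door, uncapped**: with `c_W = 2n|βt|K` and any `c` with
`e^{ε₀}c_W + max(2√N e^{ε₀} c_W, √N)·ε₁ ≤ c ≤ 1`, `c > 0`, the perturbed slab laws of every member of `ClusterDomainFR ε₀ ε₁ r` cluster with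
constants `(8N/c, (−log c)/max(n r, 1))`. [folklore] -/
theorem slabCovariance_vertex_pos [NeZero L] (hN : 1 ≤ N) (βt : ℝ) {R K : ℝ} (hK : 0 ≤ K)
    (hmod : OneLinkKRModulus N R K) (hR : |βt| * (2 * (n : ℝ)) ≤ R) {ε₀ ε₁ c : ℝ} (r : ℕ) (hc0 : 0 < c) (hc1 : c ≤ 1)
    (hcv : Real.exp ε₀ * (2 * (n : ℝ) * |βt| * K) +
      max (2 * Real.sqrt N * (Real.exp ε₀ * (2 * (n : ℝ) * |βt| * K))) (Real.sqrt N) * ε₁ ≤ c)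
    (W : Perturbation (n + 1) L N) (hWball : W ∈ ClusterDomainFR ε₀ ε₁ r)
    (v : Fin (n + 1)) (t : ZMod L) (rest : {e : Edge (n + 1) L // ¬ IsSlab v t e} → SU N) (x y : Site n L)
    (i j k l : Fin N) (φ ψ : ℂ → ℝ) (hφ : φ = Complex.re ∨ φ = Complex.im) (hψ : ψ = Complex.re ∨ ψ = Complex.im) :
    |cov[fun Q => φ ((Q x : Matrix (Fin N) (Fin N) ℂ) i j),
        fun Q => ψ ((((Q y)⁻¹ : Matrix.specialUnitaryGroup (Fin N) ℂ) : Matrix (Fin N) (Fin N) ℂ) k l);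
        slabLawW v t βt W.total rest]| ≤
      8 * N * c⁻¹ * Real.exp (-(-Real.log c / (max (n * r) 1 : ℕ)) * torusGraphDist x y) := by
  classical
  set cW : ℝ := 2 * (n : ℝ) * |βt| * K with hcW
  set M : ℝ := max (2 * Real.sqrt N * (Real.exp ε₀ * cW)) (Real.sqrt N) with hM
  obtain ⟨hrange, w, hosc, hlip⟩ := hWball
  have hcW0 : 0 ≤ cW := by positivity
  have hM0 : 0 ≤ M := le_max_of_le_right (Real.sqrt_nonneg _)
  have hsl0 : ∀ e, 0 ≤ w.selfLipLoad 0 e := fun e =>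
    Finset.sum_nonneg fun X _ => mul_nonneg (Real.exp_pos _).le ((w.lip_spec X).nonneg e)
  have hcl0 : ∀ e, 0 ≤ w.crossLipLoad 0 e := fun e => Finset.sum_nonneg fun y _ => crossLip_nonneg w 0 e y
  refine slabLawW_entry_cov_le_site_pos (n := n) (L := L) (N := N) (W := W.total) hN v t (β := βt) (R := R) (K := K)
    (δ := ε₀) (c := c) hK (fun x' => w.selfLipLoad 0 (vlinkAt v t x'))
    (fun x' => w.crossLipLoad 0 (vlinkAt v t x')) (fun x' => hsl0 _) hR hmod W.measurable_total W.exists_abs_total_le rest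
    (nbrBall r) (not_mem_nbrBall r) (fun x' η η' h => siteTiltW_total_dep W rest hrange x' η η' h)
    (fun x' ω g g' => (siteTiltW_total_osc W rest w x' ω g g').trans (hosc _))
    (fun x' ω g g' => siteTiltW_total_lip W rest w x' ω g g')
    (crossCoeff W w v t) (fun x' y' => crossCoeff_nonneg W w x' y')
    (fun x' y' ω η h => siteTiltW_total_cross W rest w x' y' h)
    (fun x' => crossCoeff_rowsum_le W w r x') hc0 hc1 (fun x' => ?_) (le_max_right _ _)
    (fun z w' hw' => dist_le_of_mem_nbr r z w' hw') x y i j k l φ ψ hφ hψ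
  set ℓ := w.selfLipLoad 0 (vlinkAt v t x') with hℓ
  set Λ := w.crossLipLoad 0 (vlinkAt v t x') with hΛ
  have hsum : ℓ + Λ ≤ ε₁ := hlip _
  have h1 : 2 * Real.sqrt N * (Real.exp ε₀ * cW) * ℓ ≤ M * ℓ := mul_le_mul_of_nonneg_right (le_max_left _ _) (hsl0 _)
  have h2 : Real.sqrt N * Λ ≤ M * Λ := mul_le_mul_of_nonneg_right (le_max_right _ _) (hcl0 _)
  calc Real.exp ε₀ * (1 + 2 * Real.sqrt N * ℓ) * cW + Real.sqrt N * Λ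
      = Real.exp ε₀ * cW + 2 * Real.sqrt N * (Real.exp ε₀ * cW) * ℓ + Real.sqrt N * Λ := by ring
    _ ≤ Real.exp ε₀ * cW + M * ℓ + M * Λ := by linarith
    _ = Real.exp ε₀ * cW + M * (ℓ + Λ) := by ring
    _ ≤ Real.exp ε₀ * cW + M * ε₁ := by nlinarith
    _ ≤ c := hcv

/-- **EXPLICIT-RATE AREA LAW ON THE BALL, AFFINE-VERTEX DOOR** (tree coupling `β`): `N ≥ 2`, one-link modulus on the slab ball `R ≥ 2n|β/N|`,
range `r`, vertical diameter `mv ≥ 1`, and any `c` with `c_v ≤ c ≤ 1`, `c > 0` (`c_v` the affine-vertex constant).  Then for every torus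
`L`, every `W ∈ ClusterDomainFR ε₀ ε₁ r` with `IsSlabLocal mv W` and every loop with `2R', 2T ≤ L`:
`|⟨W_{R'×T}⟩_{μ_{β,W,L}}| ≤ N·(32N³/c)^T·exp(−((−log c)/(max(n r,1)·mv)) R' T)`. [cite: CaoNissimSheffield2025dynamical, Theorem 2.3] -/
theorem abs_expectation_wilsonLoop_le_onBall_vertex (hN : 2 ≤ N) (β : ℝ) {R K : ℝ} (hK : 0 ≤ K)
    (hmod : OneLinkKRModulus N R K) (hR : |β / N| * (2 * (n : ℝ)) ≤ R) {ε₀ ε₁ c : ℝ} (r : ℕ) {mv : ℕ} (hmv : 1 ≤ mv)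
    (hc0 : 0 < c) (hc1 : c ≤ 1)
    (hcv : Real.exp ε₀ * (2 * (n : ℝ) * |β / N| * K) +
      max (2 * Real.sqrt N * (Real.exp ε₀ * (2 * (n : ℝ) * |β / N| * K))) (Real.sqrt N) * ε₁ ≤ c)
    (L : ℕ) [NeZero L] (W : Perturbation (n + 1) L N) (hWball : W ∈ ClusterDomainFR ε₀ ε₁ r) (hWloc : IsSlabLocal mv W)
    (x : Site (n + 1) L) {i j : Fin (n + 1)} (hij : i ≠ j) {R' T : ℕ} (hRL : 2 * R' ≤ L) (hTL : 2 * T ≤ L) :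
    |W.expectation (fundamentalRep (Fin N)) β (wilsonLoop (fundamentalRep (Fin N)) x i j R' T)| ≤
      N * (32 * (N : ℝ) ^ 3 / c) ^ T * Real.exp (-(-Real.log c / ((max (n * r) 1 : ℕ) * mv)) * ((R' : ℝ) * T)) := by
  set rW : ℕ := max (n * r) 1 with hrW
  have hNr : (N : ℝ) ≠ 0 := by exact_mod_cast (show N ≠ 0 by omega)
  have hN1 : (1 : ℝ) ≤ N := by exact_mod_cast (show 1 ≤ N by omega)
  have hβ : (N : ℝ) * (β / N) = β := by field_simp
  have hC₁ : 0 ≤ 8 * N * c⁻¹ := by positivity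
  have hC₂ : 0 ≤ -Real.log c / rW := div_nonneg (neg_nonneg.2 (Real.log_nonpos hc0.le hc1)) (Nat.cast_nonneg _)
  have h := abs_expectation_wilsonLoop_le_full_rate (n := n) (L := L) hN (β / N) W hmv
    (fun v => hasVerticalRange_total_of_isSlabLocal hWloc v)
    (fun v t U => total_slabRotate_centre_of_isSlabLocal (by omega) hWloc v t U) hC₁ hC₂
    (fun v t rest x' y' i' j' k' l' φ ψ hφ hψ =>
      slabCovariance_vertex_pos (n := n) (by omega) (β / N) hK hmod hR r hc0 hc1 hcv W hWball v t
        rest x' y' i' j' k' l' φ ψ hφ hψ) x hij hRL hTL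
  rw [hβ] at h
  have hinv : (1 : ℝ) ≤ c⁻¹ := one_le_inv_iff₀.2 ⟨hc0, hc1⟩
  have hmax : max (4 * (8 * N * c⁻¹)) 1 = 32 * N / c := by
    rw [max_eq_left (by nlinarith), div_eq_mul_inv]; ring
  have hpow : (N : ℝ) ^ 2 * (32 * N / c) = 32 * (N : ℝ) ^ 3 / c := by ring
  have hexp : -(-Real.log c / rW / mv) * ((R' : ℝ) * T) = -(-Real.log c / (rW * mv)) * ((R' : ℝ) * T) := by
    rw [div_div]
  rw [hmax, hpow, hexp] at h
  exact h

/-- **EXPLICIT AREA LAW AND STRING-TENSION FLOOR OF EVERY LIMIT STATE, AFFINE-VERTEX DOOR** (dimension `n + 1 ≥ 2`, same data): every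
infinite-volume limit state `μ` of every family eventually in `ClusterDomainFR ε₀ ε₁ r ∩ IsSlabLocal mv` satisfies
`HasAreaLawWith μ χ_N (32N³/c) ((−log c)/(r_W mv))` and has string tension `σ ≥ (−log c)/(r_W mv)` whenever it exists. [folklore] -/
theorem stringTension_ge_onBall_vertex (hN : 2 ≤ N) (hn : 1 ≤ n) (β : ℝ) {R K : ℝ} (hK : 0 ≤ K)
    (hmod : OneLinkKRModulus N R K) (hR : |β / N| * (2 * (n : ℝ)) ≤ R) {ε₀ ε₁ c : ℝ} (r : ℕ) {mv : ℕ} (hmv : 1 ≤ mv)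
    (hc0 : 0 < c) (hc1 : c ≤ 1)
    (hcv : Real.exp ε₀ * (2 * (n : ℝ) * |β / N| * K) +
      max (2 * Real.sqrt N * (Real.exp ε₀ * (2 * (n : ℝ) * |β / N| * K))) (Real.sqrt N) * ε₁ ≤ c)
    (𝓦 : PerturbationFamily (n + 1) N)
    (h𝓦 : ∀ᶠ L : ℕ in atTop, 𝓦 L ∈ ClusterDomainFR ε₀ ε₁ r ∧ IsSlabLocal mv (𝓦 L))
    {μ : Measure (LGConfig (n + 1) (SUN N))} (hμ : μ ∈ perturbedLimitPoints β 𝓦) :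
    haveI : NeZero (n + 1) := ⟨by omega⟩
    HasAreaLawWith μ (fun g => normalisedCharacter N (fundamentalRep (Fin N) g)) (32 * (N : ℝ) ^ 3 / c)
        (-Real.log c / ((max (n * r) 1 : ℕ) * mv)) ∧
      ∀ σ : ℝ, HasStringTension μ (fun g => normalisedCharacter N (fundamentalRep (Fin N) g)) σ →
        -Real.log c / ((max (n * r) 1 : ℕ) * mv) ≤ σ := by
  haveI : NeZero (n + 1) := ⟨by omega⟩
  have hN1 : (1 : ℝ) ≤ N := by exact_mod_cast (show 1 ≤ N by omega)
  have hND : (N : ℝ) ≤ 32 * (N : ℝ) ^ 3 / c := by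
    rw [le_div_iff₀ hc0]
    have h3 : (N : ℝ) ≤ (N : ℝ) ^ 3 := le_self_pow₀ hN1 (by norm_num)
    nlinarith
  have h01 : (0 : Fin (n + 1)) ≠ 1 := fin_zero_ne_one_of_two_le (by omega)
  have hA : HasAreaLawWith μ (fun g => normalisedCharacter N (fundamentalRep (Fin N) g)) (32 * (N : ℝ) ^ 3 / c)
      (-Real.log c / ((max (n * r) 1 : ℕ) * mv)) := by
    refine hasAreaLawWith_of_torusBound (β := β) (fun L => {W | W ∈ ClusterDomainFR ε₀ ε₁ r ∧ IsSlabLocal mv W})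
      (fun L W hW R' T hR' _ hRL hTL => ?_) 𝓦 h𝓦 hμ
    have h := abs_expectation_wilsonLoop_le_onBall_vertex (n := n) hN β hK hmod hR r hmv hc0 hc1 hcv (L + 1) W hW.1 hW.2
      (0 : Site (n + 1) (L + 1)) h01 hRL hTL
    exact StringTensionExplicit.le_pow_perimeter_of_le hN1 hND (Real.exp_pos _).le hR' h
  exact ⟨hA, fun σ hσ => hA.le_of_hasStringTension hσ⟩

/-! ### Certified cell: the sprint's ball of record through the vertex door -/

/-- The affine-vertex constant of the sprint ball `(β_W; ε₀, ε₁) = (1/8; 37/125, 37/250)` (`SU(2)`, `d = 4`, `K = 1`, `c_W = 3/16`) is at most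
`47/100`: `e^{37/125}·(3/16) + max(2√2·e^{37/125}·3/16, √2)·(37/250) ≤ 0.2522 + 1.415·0.148 ≤ 0.4617`. [folklore] -/
theorem sprintBall_vertexConst_le :
    Real.exp (37 / 125) * (2 * (3 : ℝ) * |(1 / 16 : ℝ) / 2| * 1) +
      max (2 * Real.sqrt 2 * (Real.exp (37 / 125) * (2 * (3 : ℝ) * |(1 / 16 : ℝ) / 2| * 1))) (Real.sqrt 2) * (37 / 250) ≤
        47 / 100 := by
  have he := StringTensionExplicit.exp_37_125_le
  have hs := sqrt_two_le_1415
  have hs1 : (1.41 : ℝ) ≤ Real.sqrt 2 := by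
    rw [show (1.41 : ℝ) = Real.sqrt (1.41 ^ 2) by rw [Real.sqrt_sq (by norm_num)]]
    exact Real.sqrt_le_sqrt (by norm_num)
  have he0 : 0 < Real.exp (37 / 125 : ℝ) := Real.exp_pos _
  have habs : |(1 / 16 : ℝ) / 2| = 1 / 32 := by rw [abs_of_nonneg (by positivity)]; norm_num
  rw [habs]
  have hmax : max (2 * Real.sqrt 2 * (Real.exp (37 / 125) * (2 * (3 : ℝ) * (1 / 32) * 1))) (Real.sqrt 2) = Real.sqrt 2 := by
    refine max_eq_right ?_
    nlinarith
  rw [hmax]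
  nlinarith

/-- ★ **STRING-TENSION FLOOR ON THE SPRINT'S BALL OF RECORD, VERTEX DOOR** (`SU(2)`, `d = 4`, `β_W = 1/8`, ball `(37/125, 37/250)`, any
range `r`, window `mv ≥ 1`): every infinite-volume limit state of every eventually-member family has
`HasAreaLawWith μ χ₂ (25600/47) (log(100/47)/(max(3r,1)·mv))` and `σ ≥ log(100/47)/(max(3r,1)·mv)` (`log(100/47) ≥ 0.755`) whenever
`σ` exists. [folklore] -/
theorem su2_stringTension_ge_sprintBall_vertex (r : ℕ) {mv : ℕ} (hmv : 1 ≤ mv) (𝓦 : PerturbationFamily 4 2)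
    (h𝓦 : ∀ᶠ L : ℕ in atTop, 𝓦 L ∈ ClusterDomainFR (37 / 125) (37 / 250) r ∧ IsSlabLocal mv (𝓦 L))
    {μ : Measure (LGConfig 4 (SUN 2))} (hμ : μ ∈ perturbedLimitPoints (1 / 16) 𝓦) :
    ∀ σ : ℝ, HasStringTension μ (fun g => normalisedCharacter 2 (fundamentalRep (Fin 2) g)) σ →
      Real.log (100 / 47) / ((max (3 * r) 1 : ℕ) * mv) ≤ σ := by
  have hmod := SlabAreaLawDimensions.su2_oneLinkKRModulus_of_le_one (R := 3 / 16) (by norm_num)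
  have habs : |(1 / 16 : ℝ) / (2 : ℕ)| = 1 / 32 := by rw [abs_of_nonneg (by positivity)]; norm_num
  have hcv : Real.exp (37 / 125) * (2 * ((3 : ℕ) : ℝ) * |(1 / 16 : ℝ) / (2 : ℕ)| * 1) +
      max (2 * Real.sqrt (2 : ℕ) * (Real.exp (37 / 125) * (2 * ((3 : ℕ) : ℝ) * |(1 / 16 : ℝ) / (2 : ℕ)| * 1))) (Real.sqrt (2 : ℕ)) *
        (37 / 250) ≤ 47 / 100 := by
    have := sprintBall_vertexConst_le; push_cast at this ⊢; exact this
  have h := (stringTension_ge_onBall_vertex (n := 3) (N := 2) le_rfl (by norm_num) (1 / 16) zero_le_one hmod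
    (by rw [habs]; norm_num) r hmv (c := 47 / 100) (by norm_num) (by norm_num) hcv 𝓦 h𝓦 hμ).2
  intro σ hσ
  have h' := h σ hσ
  have hlog : Real.log (100 / 47) = -Real.log (47 / 100) := by
    rw [← Real.log_inv]; norm_num
  rw [hlog]
  exact_mod_cast h'

end Ball

end ExplicitVertex

end Summit.Ventures.YMGap.RobustBall
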